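import Summits.ResolutionOfSingularities.ResolutionOfSingularities.Theorems.FrobeniusLadderFInjectiveMacaulayficationFedderCriterion
import Summits.ResolutionOfSingularities.ResolutionOfSingularities.Theorems.FrobeniusLadderFInjectiveMacaulayficationSliceableCentre
import Mathlib.RingTheory.Flat.FaithfullyFlat.Algebra
import HarnessLib

/-!
# FEDDER'S TEST — AND WITH IT THE CRUX'S STALK CLAUSE FOR HYPERSURFACES — ASCENDS ALONG FAITHFULLY FLAT UNRAMIFIED MAPS OF REGULAR LOCAL RINGS (the étale-transfer lemma BED Ω's
# global patch needs over B9-cure chart 5, where the change to the local-model letters is a degree-9 étale comparison, not an identity)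
# (crux `FInjectiveMacaulayfication` stmt-ResolutionOfSingularities-15315, chain w45a; res-L1-w45a-plan-1 RULING R23.17 (3) «an étale-local statement needs the FullCl étale-invariance
# lemma: say whether ✓`FullClDescent`/iso-invariance covers it or a new item is needed — if new, flag it»: it is new (✓`FullClDescent` is the DESCENT direction), and this is it, in the
# hypersurface form that suffices for pencil charts; seat res-L1-w45a-stub-1 g15)

[OURS · L1 W4.5a] Support file (`--supports stmt-ResolutionOfSingularities-15315 --as helper`); theorems only; pure commutative algebra; unconditional. Nothing of the crux is proved; no census
row is asserted. AI-written (AI review is weaker than expert review).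

SETTING. `R → R′` an algebra of LOCAL rings of characteristic `p`, FAITHFULLY FLAT, UNRAMIFIED in the form `𝔪_R·R′ = 𝔪_{R′}` (e.g. `R′` = a localisation of a standard étale
`R[T]/(h)`, `h` monic with `h′` a unit, at a point with the same residue field). §1: `x ∉ 𝔪_R^{[p]} ⇒ x ∉ 𝔪_{R′}^{[p]}` (`𝔪_{R′}^{[p]} = 𝔪_R^{[p]}·R′` by ✓ `Fedder.frobeniusPower_map`,
and `I·R′ ∩ R = I` by faithful flatness, Mathlib `Ideal.comap_map_eq_self_of_faithfullyFlat`), and conversely. §2: for `R, R′` REGULAR and `f ∈ 𝔪_R`, `f ≠ 0`, Fedder's criterion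
✓ `Fedder.fedder_criterion` (both directions, any regular local ring) turns this into: the crux's stalk clause (all s.o.p. weakly regular ∧ parameter ideals Frobenius closed) holds for
`R′/(f)` iff it holds for `R/(f)`; with `IsDomain` supplied separately (globally: blow-ups of integral schemes are integral), `FullCl` transfers.
* §1 `not_mem_frobeniusPower_of_faithfullyFlat`, `not_mem_frobeniusPower_of_map`; §2 ★★ `clause_hypersurface_of_fedder_downstairs`, ★★ `clause_hypersurface_iff_of_faithfullyFlat`,
  ★ `fullCl_hypersurface_of_faithfullyFlat`.
[cite: Fedder1983, Prop. 1.7 and Thm. 1.12; Matsumura1987, Thm. 7.5 (faithful flatness)]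
-/

-- single-problem summit: the doubled namespace component is forced
set_option linter.dupNamespace false

noncomputable section

namespace Summit.ResolutionOfSingularities.ResolutionOfSingularities.Theorems.FInjectiveMacaulayfication.FedderEtaleAscent

open IsLocalRing Literature.RingTheory.TightClosure
open Summit.ResolutionOfSingularities.ResolutionOfSingularities.Theorems.FInjectiveMacaulayfication SliceableCentre

variable {R R' : Type} [CommRing R] [CommRing R'] [Algebra R R']

/-! ## §1 Frobenius powers of the maximal ideal along faithfully flat unramified maps -/

/-- `𝔪_{R′}^{[p]} = 𝔪_R^{[p]}·R′` when `𝔪_R·R′ = 𝔪_{R′}`. [plumbing; ✓ `Fedder.frobeniusPower_map`] -/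
theorem frobeniusPower_maximalIdeal_eq_map (p : ℕ) [Fact p.Prime] [CharP R p] [CharP R' p] [IsLocalRing R] [IsLocalRing R']
    (hunr : (maximalIdeal R).map (algebraMap R R') = maximalIdeal R') :
    frobeniusPower p (maximalIdeal R') = (frobeniusPower p (maximalIdeal R)).map (algebraMap R R') := by
  haveI : ExpChar R p := ExpChar.prime Fact.out
  haveI : ExpChar R' p := ExpChar.prime Fact.out
  have h := Fedder.frobeniusPower_map p (algebraMap R R') 1 (maximalIdeal R)
  rw [pow_one, hunr] at h
  exact h

/-- **NON-MEMBERSHIP IN `𝔪^{[p]}` ASCENDS** along a faithfully flat map of local rings with `𝔪_R·R′ = 𝔪_{R′}`. [folklore; faithful flatness] -/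
theorem not_mem_frobeniusPower_of_faithfullyFlat (p : ℕ) [Fact p.Prime] [CharP R p] [CharP R' p] [IsLocalRing R] [IsLocalRing R'] [Module.FaithfullyFlat R R']
    (hunr : (maximalIdeal R).map (algebraMap R R') = maximalIdeal R') {x : R} (hx : x ∉ frobeniusPower p (maximalIdeal R)) :
    algebraMap R R' x ∉ frobeniusPower p (maximalIdeal R') := by
  intro h
  apply hx
  rw [frobeniusPower_maximalIdeal_eq_map p hunr] at h
  rw [← Ideal.comap_map_eq_self_of_faithfullyFlat (B := R') (frobeniusPower p (maximalIdeal R))]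
  exact Ideal.mem_comap.2 h

/-- … and DESCENDS (the trivial direction). [plumbing] -/
theorem not_mem_frobeniusPower_of_map (p : ℕ) [Fact p.Prime] [CharP R p] [CharP R' p] [IsLocalRing R] [IsLocalRing R']
    (hunr : (maximalIdeal R).map (algebraMap R R') = maximalIdeal R') {x : R} (hx : algebraMap R R' x ∉ frobeniusPower p (maximalIdeal R')) :
    x ∉ frobeniusPower p (maximalIdeal R) := fun h => by
  rw [frobeniusPower_maximalIdeal_eq_map p hunr] at hx
  exact hx (Ideal.mem_map_of_mem _ h)

/-! ## §2 ★★ The stalk clause of a hypersurface transfers -/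

/-- ★★ **THE CLAUSE UPSTAIRS FROM FEDDER'S TEST DOWNSTAIRS**: `R → R′` faithfully flat unramified of REGULAR local rings, `f ∈ 𝔪_R` with `f^{p−1} ∉ 𝔪_R^{[p]}` ⇒ `R′/(f)` satisfies the crux's
stalk clause (all s.o.p. weakly regular, all parameter ideals Frobenius closed). [OURS · BED Ω global patch (chart 5); cite: Fedder1983, Thm. 1.12] -/
theorem clause_hypersurface_of_fedder_downstairs (p : ℕ) [Fact p.Prime] [IsRegularLocalRing R] [IsRegularLocalRing R'] [CharP R p] [CharP R' p] [Module.FaithfullyFlat R R']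
    (hunr : (maximalIdeal R).map (algebraMap R R') = maximalIdeal R') (f : R) (hfm : f ∈ maximalIdeal R) (hf0 : f ≠ 0)
    (hfed : f ^ (p - 1) ∉ frobeniusPower p (maximalIdeal R)) :
    ∀ d : ℕ, ringKrullDim (R' ⧸ Ideal.span {algebraMap R R' f}) = d → ∀ s : Fin d → R' ⧸ Ideal.span {algebraMap R R' f},
      (Ideal.span (Set.range s)).radical.IsMaximal →
        RingTheory.Sequence.IsWeaklyRegular (R' ⧸ Ideal.span {algebraMap R R' f}) (List.ofFn s) ∧
        ∀ y : R' ⧸ Ideal.span {algebraMap R R' f}, (∃ e : ℕ, y ^ p ^ e ∈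
            Ideal.span ((fun z : R' ⧸ Ideal.span {algebraMap R R' f} => z ^ p ^ e) '' (Ideal.span (Set.range s) : Set (R' ⧸ Ideal.span {algebraMap R R' f})))) →
          y ∈ Ideal.span (Set.range s) := by
  have hfm' : algebraMap R R' f ∈ maximalIdeal R' := by rw [← hunr]; exact Ideal.mem_map_of_mem _ hfm
  have hf0' : algebraMap R R' f ≠ 0 := fun h => hf0 (FaithfulSMul.algebraMap_injective R R' (by rw [h, map_zero]))
  have hfed' : (algebraMap R R' f) ^ (p - 1) ∉ frobeniusPower p (maximalIdeal R') := by
    rw [← map_pow]; exact not_mem_frobeniusPower_of_faithfullyFlat p hunr hfed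
  exact (Fedder.fedder_criterion p R' (algebraMap R R' f) hfm' hf0').2 hfed'

/-- ★★ **THE CLAUSE IS INVARIANT**: along a faithfully flat unramified map of regular local rings, `R/(f)` satisfies the clause iff `R′/(f)` does (Fedder's criterion on both sides and §1).
[OURS; cite: Fedder1983, Thm. 1.12] -/
theorem clause_hypersurface_iff_of_faithfullyFlat (p : ℕ) [Fact p.Prime] [IsRegularLocalRing R] [IsRegularLocalRing R'] [CharP R p] [CharP R' p] [Module.FaithfullyFlat R R']
    (hunr : (maximalIdeal R).map (algebraMap R R') = maximalIdeal R') (f : R) (hfm : f ∈ maximalIdeal R) (hf0 : f ≠ 0) :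
    (∀ d : ℕ, ringKrullDim (R ⧸ Ideal.span {f}) = d → ∀ s : Fin d → R ⧸ Ideal.span {f},
      (Ideal.span (Set.range s)).radical.IsMaximal →
        RingTheory.Sequence.IsWeaklyRegular (R ⧸ Ideal.span {f}) (List.ofFn s) ∧
        ∀ y : R ⧸ Ideal.span {f}, (∃ e : ℕ, y ^ p ^ e ∈
            Ideal.span ((fun z : R ⧸ Ideal.span {f} => z ^ p ^ e) '' (Ideal.span (Set.range s) : Set (R ⧸ Ideal.span {f})))) →
          y ∈ Ideal.span (Set.range s)) ↔
    (∀ d : ℕ, ringKrullDim (R' ⧸ Ideal.span {algebraMap R R' f}) = d → ∀ s : Fin d → R' ⧸ Ideal.span {algebraMap R R' f},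
      (Ideal.span (Set.range s)).radical.IsMaximal →
        RingTheory.Sequence.IsWeaklyRegular (R' ⧸ Ideal.span {algebraMap R R' f}) (List.ofFn s) ∧
        ∀ y : R' ⧸ Ideal.span {algebraMap R R' f}, (∃ e : ℕ, y ^ p ^ e ∈
            Ideal.span ((fun z : R' ⧸ Ideal.span {algebraMap R R' f} => z ^ p ^ e) '' (Ideal.span (Set.range s) : Set (R' ⧸ Ideal.span {algebraMap R R' f})))) →
          y ∈ Ideal.span (Set.range s)) := by
  have hfm' : algebraMap R R' f ∈ maximalIdeal R' := by rw [← hunr]; exact Ideal.mem_map_of_mem _ hfm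
  have hf0' : algebraMap R R' f ≠ 0 := fun h => hf0 (FaithfulSMul.algebraMap_injective R R' (by rw [h, map_zero]))
  rw [Fedder.fedder_criterion p R f hfm hf0, Fedder.fedder_criterion p R' (algebraMap R R' f) hfm' hf0', ← map_pow]
  exact ⟨not_mem_frobeniusPower_of_faithfullyFlat p hunr, not_mem_frobeniusPower_of_map p hunr⟩

/-- ★ **`FullCl` OF THE HYPERSURFACE UPSTAIRS** from the clause downstairs and integrality upstairs (the domain clause is NOT étale-local — it is supplied by the consumer, e.g. from
the integrality of blow-ups of integral schemes). [OURS · BED Ω global patch] -/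
theorem fullCl_hypersurface_of_faithfullyFlat (p : ℕ) [Fact p.Prime] [IsRegularLocalRing R] [IsRegularLocalRing R'] [CharP R p] [CharP R' p] [Module.FaithfullyFlat R R']
    (hunr : (maximalIdeal R).map (algebraMap R R') = maximalIdeal R') (f : R) (hfm : f ∈ maximalIdeal R) (hf0 : f ≠ 0)
    (hR : FullCl p (R ⧸ Ideal.span {f})) (hdom : IsDomain (R' ⧸ Ideal.span {algebraMap R R' f})) :
    FullCl p (R' ⧸ Ideal.span {algebraMap R R' f}) :=
  ⟨hdom, (clause_hypersurface_iff_of_faithfullyFlat p hunr f hfm hf0).1 hR.2⟩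

end Summit.ResolutionOfSingularities.ResolutionOfSingularities.Theorems.FInjectiveMacaulayfication.FedderEtaleAscent

end
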